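import Summits.BirchSwinnertonDyer.Rank1Residual.Additive.SpecialJOrdinary
import Mathlib.Data.Nat.Choose.Lucas
import HarnessLib

/-!
# Additive classes X3/X4: elliptic curves with `j ∈ {0, 1728}` over a finite field of characteristic `p ≢ 1 (mod 3)` resp. `(mod 4)` are SUPERSINGULAR

HONEST FRAMING (cell `b2b-bsdres`, run/shared/lean/b2b/bsd-rank1-residual/, verbatim in every
file): the goal of the cell is to DELETE the COMBINATION-SHAPED residual classes of the
Birch–Swinnerton-Dyer formula for ALL analytic-rank `≤ 1` elliptic curves over `ℚ` — "full BSD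
formula for every rank `≤ 1` curve in class `C`" assembled STRICTLY from published theorems — so
that the rank-`≤ 1` remainder becomes exactly the CONSTRUCTION-SHAPED classes, which are TYPED
(missing-input `Prop`s), NOT attempted. This is not "finishing BSD". Sub-cell `additive-p2`
(X3/X4 at an additive prime, potentially good ORDINARY half), generation 9: research route; no
claim beyond the stated classes; theorems only, no named fact; X3♯(G-ord)/X4♯(G-ord) stay
CONSTRUCTION-SHAPED.

The CONVERSE half of Deuring's criterion for the special `j`-invariants, over an ARBITRARY finite
field `F` of characteristic `p ≥ 5` (`q = p^f` elements, any `f`): an elliptic curve with `j = 0`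
is SUPERSINGULAR — `p ∣ q + 1 − #E(F)`, i.e. the tree's unit-root integer of
`WeierstrassCurve.HasUnitRootAt` is divisible by `p` — as soon as `p ≢ 1 (mod 3)`, and one with
`j = 1728` is supersingular as soon as `p ≢ 1 (mod 4)` (Silverman *AEC* V.4.1(a), Ex. V.4.4–4.5:
"`y² = x³ + 1` is supersingular iff `p ≡ 2 (mod 3)`", "`y² = x³ + x` is supersingular iff
`p ≡ 3 (mod 4)`"). Gen 3's `SpecialJOrdinary.lean` proved the ORDINARY half (over `𝔽_p`); this
file is its complement and is what the sibling file `PotentiallyOrdinaryTypeG.lean` needs to show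
that an additive pair which is potentially good ORDINARY over SOME number field at SOME place above
`p` is of Delbourgo type (G): ordinarity of the reduction `j̃ ∈ {0, 1728}` forces `3 ∣ p − 1`
resp. `4 ∣ p − 1`, hence `e_E(p) ∣ p − 1`.

Method (Euler's criterion, as in `SpecialJOrdinary.lean`): in `F`,
`q + 1 − #E(F) = −Σ_{x ∈ F} (x³ + a x + b)^{(q−1)/2}` (`SpecialJ.intCast_trace_eq_neg_sum_pow`);
for `y² = x³ + b` the only monomial of `(x³ + b)^m`, `m = (q−1)/2`, with a nonzero power sum is
`x^{q−1}`, present iff `3 ∣ q − 1`, with coefficient `C(m, (q−1)/3)·b^{(q−1)/6}`; so the trace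
vanishes in `F` when `3 ∤ q − 1` (`sum_pow_cubic_of_a₄_eq_zero_of_not_three_dvd`), and when
`3 ∣ q − 1` but `3 ∤ p − 1` the binomial coefficient is divisible by `p` by ONE step of Lucas's
theorem (Mathlib `Choose.choose_modEq_choose_mod_mul_choose_div_nat`): `m ≡ (p−1)/2 (mod p)` while
the residue `s` of `(q−1)/3` satisfies `p ∣ 3s + 1`, which for `s ≤ (p−1)/2` forces `3s + 1 = p`,
i.e. `3 ∣ p − 1` (`dvd_choose_div_of_not_dvd_sub_one`, stated for a divisor `d ≤ 4` of `q − 1` so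
that it serves `d = 3` and `d = 4` at once). The case `j = 1728`, `y² = x³ + a x`, is identical
with the monomial `x^{m + 2k}` and `d = 4`. General equations in characteristic `≠ 2, 3` are
brought to short normal form (Mathlib `toShortNF`; same point count by the tree's
`VariableChange.pointEquiv`; `j = 0 ⟺ a₄ = 0`, `j = 1728 ⟺ a₆ = 0`, gen 3). Main statements:
`ringChar_dvd_trace_of_a₄_eq_zero`, `ringChar_dvd_trace_of_a₆_eq_zero`,
`ringChar_dvd_trace_of_j_eq_zero`, `ringChar_dvd_trace_of_j_eq` (`j = 1728`), and the `Nat.card`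
forms `dvd_trace_of_j_eq_zero_of_ringChar_eq`, `dvd_trace_of_j_eq_of_ringChar_eq` used at the
residue field of a number field.

References: M. Deuring, Abh. Math. Sem. Hamburg 14 (1941) 197–272; J. H. Silverman, *AEC*
Thm. V.4.1(a), Ex. V.4.4, V.4.5; L. C. Washington, *Elliptic Curves* (2nd ed.) §4.6 (Prop. 4.33,
Prop. 4.37); K. Ireland, M. Rosen, GTM 84, Ch. 18 §§3–4; É. Lucas, Amer. J. Math. 1 (1878) §XXI
(Mathlib `Mathlib.Data.Nat.Choose.Lucas`).
-/

noncomputable section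

open scoped Classical

open Finset Polynomial WeierstrassCurve Literature.NumberTheory.EllipticCurves.HasseElementary

namespace Summit.BirchSwinnertonDyer.Rank1Residual.Additive

namespace SpecialJ

/-! ### One step of Lucas: `p ∣ C((q−1)/2, (q−1)/d)` for `d ∈ {3, 4}`, `d ∤ p − 1` -/

/-- **Lucas step.** Let `p` be a prime dividing the odd number `q = 2m + 1`, and `d ∣ q − 1` with
`1 ≤ d ≤ 4` and `d ∤ p − 1`. Then `p ∣ C(m, (q−1)/d)`. Indeed `m ≡ (p−1)/2 (mod p)`
(`p ∣ 2m + 1`), and the residue `s = ((q−1)/d) mod p` has `p ∣ d s + 1`; if `s ≤ (p−1)/2` then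
`0 < d s + 1 ≤ 2p − 1`, so `d s + 1 = p` and `d ∣ p − 1` — excluded; hence `s > m mod p`, the
bottom Lucas factor `C(m mod p, s)` vanishes, and `C(m, (q−1)/d) ≡ 0 (mod p)`
(Mathlib `Choose.choose_modEq_choose_mod_mul_choose_div_nat`). Used with `q = #F = p^f`,
`d = 3` (`j = 0`) and `d = 4` (`j = 1728`). -/
theorem dvd_choose_div_of_not_dvd_sub_one {p q m d : ℕ} [hp : Fact p.Prime] (hpq : p ∣ q)
    (hq : q = 2 * m + 1) (hd : d ∣ q - 1) (hd1 : 1 ≤ d) (hd4 : d ≤ 4) (hnd : ¬ d ∣ p - 1) :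
    p ∣ m.choose ((q - 1) / d) := by
  obtain ⟨k, hk⟩ := hd
  have hkq : (q - 1) / d = k := by rw [hk, Nat.mul_div_cancel_left _ (by omega)]
  rw [hkq]
  have hp1 : 1 < p := hp.out.one_lt
  -- `m mod p = (p - 1)/2`
  have hpm : p ∣ 2 * (m % p) + 1 := by
    have h1 : 2 * (m % p) + 1 ≡ 2 * m + 1 [MOD p] :=
      Nat.ModEq.add_right 1 (Nat.ModEq.mul_left 2 (Nat.mod_modEq m p))
    have h0 : 2 * m + 1 ≡ 0 [MOD p] := by rw [← hq]; exact Nat.modEq_zero_iff_dvd.mpr hpq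
    exact (Nat.modEq_zero_iff_dvd.mp (h1.trans h0))
  have hr : 2 * (m % p) + 1 = p := by
    obtain ⟨c, hc⟩ := hpm
    have hlt : m % p < p := Nat.mod_lt _ hp.out.pos
    have hc2 : c < 2 := by
      by_contra hc2
      push Not at hc2
      have : p * 2 ≤ p * c := Nat.mul_le_mul_left p hc2
      omega
    interval_cases c <;> omega
  -- `p ∣ d s + 1` for `s = k mod p`
  have hps : p ∣ d * (k % p) + 1 := by
    have h1 : d * (k % p) + 1 ≡ d * k + 1 [MOD p] :=
      Nat.ModEq.add_right 1 (Nat.ModEq.mul_left d (Nat.mod_modEq k p))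
    have h0 : d * k + 1 ≡ 0 [MOD p] := by
      have hdk : d * k + 1 = q := by omega
      rw [hdk]; exact Nat.modEq_zero_iff_dvd.mpr hpq
    exact (Nat.modEq_zero_iff_dvd.mp (h1.trans h0))
  -- hence `m mod p < k mod p`
  have hlt : m % p < k % p := by
    by_contra hle
    push Not at hle
    obtain ⟨c, hc⟩ := hps
    have hmul : d * (k % p) ≤ 4 * (m % p) := Nat.mul_le_mul hd4 hle
    have hc2 : c < 2 := by
      by_contra hc2
      push Not at hc2
      have : p * 2 ≤ p * c := Nat.mul_le_mul_left p hc2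
      omega
    interval_cases c
    · omega
    · exact hnd ⟨k % p, by omega⟩
  have hL := Choose.choose_modEq_choose_mod_mul_choose_div_nat (n := m) (k := k) (p := p)
  rw [Nat.choose_eq_zero_of_lt hlt, zero_mul] at hL
  exact Nat.modEq_zero_iff_dvd.mp hL

variable {F : Type*} [Field F] [Fintype F]

/-! ### Short Weierstrass curves: the vanishing power sums -/

section ShortNF

variable (E : WeierstrassCurve F) [E.IsShortNF] [E.IsElliptic]

omit [E.IsShortNF] [E.IsElliptic] in
/-- **`j = 0` (`y² = x³ + b`), `q ≢ 1 (mod 3)`**: `Σ_{x ∈ F} (x³ + b)^{(q−1)/2} = 0` — no monomial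
`x^{3k}`, `0 < 3k ≤ 3(q−1)/2`, has exponent divisible by `q − 1`. Ireland–Rosen Ch. 18 §3;
Washington §4.6. -/
theorem sum_pow_cubic_of_a₄_eq_zero_of_not_three_dvd (hF : ringChar F ≠ 2) (ha : E.a₄ = 0)
    (h3 : ¬ 3 ∣ Fintype.card F - 1) :
    ∑ x : F, ((cubic E).eval x) ^ (Fintype.card F / 2) = 0 := by
  set q := Fintype.card F with hqdef
  set m := q / 2 with hmdef
  have hq : q = 2 * m + 1 := card_eq_two_mul_add_one hF
  have hm0 : 0 < m := by
    have := Fintype.one_lt_card (α := F)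
    omega
  have hexp : ∀ x : F, ((cubic E).eval x) ^ m =
      ∑ k ∈ range (m + 1), (m.choose k : F) * E.a₆ ^ (m - k) * x ^ (3 * k) := by
    intro x
    rw [eval_cubic, ha, zero_mul, add_zero, add_pow]
    refine sum_congr rfl fun k _ ↦ ?_
    rw [← pow_mul]
    ring
  simp_rw [hexp]
  rw [sum_comm]
  refine sum_eq_zero fun k hk ↦ ?_
  rw [mem_range] at hk
  rw [← mul_sum]
  by_cases hk0 : k = 0
  · subst hk0
    simp only [mul_zero, pow_zero, sum_const, card_univ, nsmul_eq_mul, mul_one]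
    rw [← hqdef, FiniteField.cast_card_eq_zero, mul_zero]
  · rw [sum_pow_eq_ite_eq (3 * k) (by omega) (by omega), if_neg, mul_zero]
    intro h3k
    exact h3 ⟨k, by omega⟩

omit [E.IsShortNF] [E.IsElliptic] in
/-- **`j = 1728` (`y² = x³ + a x`), `q ≢ 1 (mod 4)`**: `Σ_{x ∈ F} (x³ + a x)^{(q−1)/2} = 0` — the
monomials are `x^{m + 2k}`, `0 ≤ k ≤ m`, and `m + 2k = q − 1 = 2m` would need `m` even.
Ireland–Rosen Ch. 18 §4; Washington §4.6. -/
theorem sum_pow_cubic_of_a₆_eq_zero_of_not_four_dvd (hF : ringChar F ≠ 2) (hb : E.a₆ = 0)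
    (h4 : ¬ 4 ∣ Fintype.card F - 1) :
    ∑ x : F, ((cubic E).eval x) ^ (Fintype.card F / 2) = 0 := by
  set q := Fintype.card F with hqdef
  set m := q / 2 with hmdef
  have hq : q = 2 * m + 1 := card_eq_two_mul_add_one hF
  have hm0 : 0 < m := by
    have := Fintype.one_lt_card (α := F)
    omega
  have hexp : ∀ x : F, ((cubic E).eval x) ^ m =
      ∑ k ∈ range (m + 1), (m.choose k : F) * E.a₄ ^ (m - k) * x ^ (m + 2 * k) := by
    intro x
    rw [eval_cubic, hb, add_zero, add_pow]
    refine sum_congr rfl fun k hk ↦ ?_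
    rw [mem_range] at hk
    rw [mul_pow, ← pow_mul]
    have : x ^ (3 * k) * x ^ (m - k) = x ^ (m + 2 * k) := by
      rw [← pow_add]; congr 1; omega
    calc x ^ (3 * k) * (E.a₄ ^ (m - k) * x ^ (m - k)) * (m.choose k : F)
        = (m.choose k : F) * E.a₄ ^ (m - k) * (x ^ (3 * k) * x ^ (m - k)) := by ring
      _ = (m.choose k : F) * E.a₄ ^ (m - k) * x ^ (m + 2 * k) := by rw [this]
  simp_rw [hexp]
  rw [sum_comm]
  refine sum_eq_zero fun k hk ↦ ?_
  rw [mem_range] at hk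
  rw [← mul_sum, sum_pow_eq_ite_eq (m + 2 * k) (by omega) (by omega), if_neg, mul_zero]
  intro hmk
  exact h4 ⟨k, by omega⟩

/-! ### Short Weierstrass curves: `p ∣ q + 1 − #E(F)` -/

variable {p : ℕ} [hp : Fact p.Prime]

omit [E.IsShortNF] [E.IsElliptic] hp in
/-- In characteristic `p`, `p` divides `q = #F`. -/
theorem ringChar_dvd_card (hchar : ringChar F = p) : p ∣ Fintype.card F := by
  subst hchar
  obtain ⟨n, -, hn⟩ := FiniteField.card F (ringChar F)
  rw [hn]
  exact dvd_pow_self _ (PNat.ne_zero n)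

/-- **`y² = x³ + b` is supersingular in characteristic `p ≢ 1 (mod 3)`** (`p` odd): `p` divides
`q + 1 − #E(F)`, the integer tested by the tree's `HasUnitRootAt`. Silverman *AEC* Ex. V.4.4;
Washington Prop. 4.33. -/
theorem ringChar_dvd_trace_of_a₄_eq_zero (hchar : ringChar F = p) (hp2 : p ≠ 2) (ha : E.a₄ = 0)
    (h3 : ¬ 3 ∣ p - 1) :
    (p : ℤ) ∣ (Fintype.card F : ℤ) + 1 - Nat.card E.toAffine.Point := by
  have hF : ringChar F ≠ 2 := by rw [hchar]; exact hp2
  have hpq : p ∣ Fintype.card F := ringChar_dvd_card hchar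
  subst hchar
  apply (CharP.intCast_eq_zero_iff F (ringChar F) _).mp
  rw [intCast_trace_eq_neg_sum_pow E hF, neg_eq_zero]
  by_cases h3q : 3 ∣ Fintype.card F - 1
  · rw [sum_pow_cubic_of_a₄_eq_zero E hF ha h3q, neg_eq_zero]
    have hdvd := dvd_choose_div_of_not_dvd_sub_one (p := ringChar F) hpq
      (card_eq_two_mul_add_one hF) h3q (by norm_num) (by norm_num) h3
    rw [(CharP.cast_eq_zero_iff F (ringChar F) _).mpr hdvd, zero_mul]
  · exact sum_pow_cubic_of_a₄_eq_zero_of_not_three_dvd E hF ha h3q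

/-- **`y² = x³ + a x` is supersingular in characteristic `p ≢ 1 (mod 4)`** (`p` odd):
`p ∣ q + 1 − #E(F)`. Silverman *AEC* Ex. V.4.5; Washington Prop. 4.37. -/
theorem ringChar_dvd_trace_of_a₆_eq_zero (hchar : ringChar F = p) (hp2 : p ≠ 2) (hb : E.a₆ = 0)
    (h4 : ¬ 4 ∣ p - 1) :
    (p : ℤ) ∣ (Fintype.card F : ℤ) + 1 - Nat.card E.toAffine.Point := by
  have hF : ringChar F ≠ 2 := by rw [hchar]; exact hp2
  have hpq : p ∣ Fintype.card F := ringChar_dvd_card hchar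
  subst hchar
  apply (CharP.intCast_eq_zero_iff F (ringChar F) _).mp
  rw [intCast_trace_eq_neg_sum_pow E hF, neg_eq_zero]
  by_cases h4q : 4 ∣ Fintype.card F - 1
  · rw [sum_pow_cubic_of_a₆_eq_zero E hF hb h4q, neg_eq_zero]
    have hdvd := dvd_choose_div_of_not_dvd_sub_one (p := ringChar F) hpq
      (card_eq_two_mul_add_one hF) h4q (by norm_num) (by norm_num) h4
    rw [(CharP.cast_eq_zero_iff F (ringChar F) _).mpr hdvd, zero_mul]
  · exact sum_pow_cubic_of_a₆_eq_zero_of_not_four_dvd E hF hb h4q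

end ShortNF

/-! ### General Weierstrass equations in characteristic `p ≥ 5` -/

section General

variable (E : WeierstrassCurve F) [E.IsElliptic] {p : ℕ} [hp : Fact p.Prime]

omit [Fintype F] [E.IsElliptic] hp in
/-- In characteristic `p ≥ 5`, `ringChar F ≠ 2, 3`. -/
theorem ringChar_ne_two_and_ne_three (hchar : ringChar F = p) (hp5 : 5 ≤ p) :
    ringChar F ≠ 2 ∧ ringChar F ≠ 3 := by
  rw [hchar]; constructor <;> omega

/-- **An elliptic curve with `j = 0` over a finite field of characteristic `p ≥ 5`,
`p ≢ 1 (mod 3)`, is SUPERSINGULAR**: `p ∣ q + 1 − #E(F)`. Reduction to short normal form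
(`E.toShortNF • E`, same point count by the tree's `VariableChange.pointEquiv`;
`j = 0 ⟺ c₄ = 0 ⟺ a₄ = 0`). Deuring 1941; Silverman *AEC* V.4.1(a) + Ex. V.4.4. -/
theorem ringChar_dvd_trace_of_j_eq_zero (hchar : ringChar F = p) (hp5 : 5 ≤ p) (hj : E.j = 0)
    (h3 : ¬ 3 ∣ p - 1) :
    (p : ℤ) ∣ (Fintype.card F : ℤ) + 1 - Nat.card E.toAffine.Point := by
  obtain ⟨h2, h3'⟩ := ringChar_ne_two_and_ne_three hchar hp5
  obtain ⟨h2', h3''⟩ := two_ne_zero_and_three_ne_zero h2 h3'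
  haveI : Invertible (2 : F) := invertibleOfNonzero h2'
  haveI : Invertible (3 : F) := invertibleOfNonzero h3''
  haveI : (E.toShortNF • E).IsShortNF := E.toShortNF_spec
  have hjS : (E.toShortNF • E).j = 0 := by rw [variableChange_j, hj]
  have hc4 : (E.toShortNF • E).c₄ = 0 := (j_eq_zero_iff _).mp hjS
  have ha4 : (E.toShortNF • E).a₄ = 0 := by
    rw [(E.toShortNF • E).c₄_of_isShortNF] at hc4
    have h48 : (-48 : F) ≠ 0 := by
      rw [show (-48 : F) = -(2 ^ 4 * 3) by norm_num]
      exact neg_ne_zero.mpr (mul_ne_zero (pow_ne_zero _ h2') h3'')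
    exact (mul_eq_zero.mp hc4).resolve_left h48
  rw [Nat.card_congr (VariableChange.pointEquiv E E.toShortNF).toEquiv]
  exact ringChar_dvd_trace_of_a₄_eq_zero (E.toShortNF • E) hchar (by omega) ha4 h3

/-- **An elliptic curve with `j = 1728` over a finite field of characteristic `p ≥ 5`,
`p ≢ 1 (mod 4)`, is SUPERSINGULAR**: `p ∣ q + 1 − #E(F)` (`j = 1728 ⟺ c₆ = 0 ⟺ a₆ = 0`).
Deuring 1941; Silverman *AEC* V.4.1(a) + Ex. V.4.5. -/
theorem ringChar_dvd_trace_of_j_eq (hchar : ringChar F = p) (hp5 : 5 ≤ p) (hj : E.j = 1728)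
    (h4 : ¬ 4 ∣ p - 1) :
    (p : ℤ) ∣ (Fintype.card F : ℤ) + 1 - Nat.card E.toAffine.Point := by
  obtain ⟨h2, h3'⟩ := ringChar_ne_two_and_ne_three hchar hp5
  obtain ⟨h2', h3''⟩ := two_ne_zero_and_three_ne_zero h2 h3'
  haveI : Invertible (2 : F) := invertibleOfNonzero h2'
  haveI : Invertible (3 : F) := invertibleOfNonzero h3''
  haveI : (E.toShortNF • E).IsShortNF := E.toShortNF_spec
  have hjS : (E.toShortNF • E).j = 1728 := by rw [variableChange_j, hj]
  have hc6 : (E.toShortNF • E).c₆ = 0 := (j_eq_iff_c₆_eq_zero _).mp hjS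
  have ha6 : (E.toShortNF • E).a₆ = 0 := by
    rw [(E.toShortNF • E).c₆_of_isShortNF] at hc6
    have h864 : (-864 : F) ≠ 0 := by
      rw [show (-864 : F) = -(2 ^ 5 * 3 ^ 3) by norm_num]
      exact neg_ne_zero.mpr (mul_ne_zero (pow_ne_zero _ h2') (pow_ne_zero _ h3''))
    exact (mul_eq_zero.mp hc6).resolve_left h864
  rw [Nat.card_congr (VariableChange.pointEquiv E E.toShortNF).toEquiv]
  exact ringChar_dvd_trace_of_a₆_eq_zero (E.toShortNF • E) hchar (by omega) ha6 h4

end General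

/-! ### `Nat.card` forms (residue fields of number fields are `Finite`, not `Fintype`) -/

section NatCard

variable {k : Type*} [Field k] [Finite k] (E : WeierstrassCurve k) [E.IsElliptic] {p : ℕ}
  [hp : Fact p.Prime]

/-- **Supersingular reduction for `j = 0`, characteristic `p ≥ 5`, `p ≢ 1 (mod 3)`**: for an
elliptic curve `E` over a finite field `k` of characteristic `p` (any degree over `𝔽_p`) with
`j(E) = 0`, `p ∣ #k + 1 − #E(k)` — the NEGATION of the unit-root / ordinary condition of the
tree's `WeierstrassCurve.HasUnitRootAt`. Converse companion of gen 3's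
`not_dvd_trace_of_j_eq_zero_of_card_eq`. Deuring 1941; Silverman *AEC* V.4.1(a), Ex. V.4.4. -/
theorem dvd_trace_of_j_eq_zero_of_ringChar_eq (hchar : ringChar k = p) (hp5 : 5 ≤ p)
    (hj : E.j = 0) (h3 : ¬ 3 ∣ p - 1) :
    (p : ℤ) ∣ (Nat.card k : ℤ) + 1 - Nat.card E.toAffine.Point := by
  haveI := Fintype.ofFinite k
  rw [Nat.card_eq_fintype_card]
  exact ringChar_dvd_trace_of_j_eq_zero E hchar hp5 hj h3

/-- **Supersingular reduction for `j = 1728`, characteristic `p ≥ 5`, `p ≢ 1 (mod 4)`**: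
`p ∣ #k + 1 − #E(k)`. Converse companion of gen 3's `not_dvd_trace_of_j_eq_of_card_eq`.
Deuring 1941; Silverman *AEC* V.4.1(a), Ex. V.4.5. -/
theorem dvd_trace_of_j_eq_of_ringChar_eq (hchar : ringChar k = p) (hp5 : 5 ≤ p)
    (hj : E.j = 1728) (h4 : ¬ 4 ∣ p - 1) :
    (p : ℤ) ∣ (Nat.card k : ℤ) + 1 - Nat.card E.toAffine.Point := by
  haveI := Fintype.ofFinite k
  rw [Nat.card_eq_fintype_card]
  exact ringChar_dvd_trace_of_j_eq E hchar hp5 hj h4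

end NatCard

end SpecialJ

end Summit.BirchSwinnertonDyer.Rank1Residual.Additive

end
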